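import Summits.CriticalPhenomena.PercolationContinuityZ3.Theorems.PercNearOneGluingNoHeavyLowerTailThreePartitionADTwisted
import HarnessLib.Audit

/-!
# `NoHeavyLowerTail` (crux stmt-CriticalPhenomena-4575), master-family hierarchy P3 (gen 33): the comb form of Sahi's `C₃` as a
# TRANSPORT statement on the grid `[3]^n` — the kernel form of the twisted three-partition functional and the conjecture `GridTransport`

Support file (seat `prim-masterthm-p3`; `--supports stmt-CriticalPhenomena-4575`; memo
`run/shared/lean/prim/prim-masterthm/FROM-prim-masterthm-p3-g33-CORE-PROVED.md` §6, HIERARCHY §40(f)).  Companion of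
`…ThreePartitionADTwisted` (`threePartNT`, `ThreePartitionPositivityTwisted` ≡ COMB-C3 ⟹ Sahi's `C₃` for product measures).

THE KERNEL FORM (this work, proved).  A configuration is an ordered 3-partition `(S₁,S₂,S₃)` of `ι`, encoded by the disjoint pair
`q = (S₁,S₂)`; its three COPIES are `x_a = S_a ∆ τ`.  With the canonical three-copy kernel (test family on copy 1)
  `κ_{τ,𝒱,𝒲}(q) = 2[x₁ ∈ 𝒱∩𝒲] + [x₂ ∈ 𝒱][x₃ ∈ 𝒲] − [x₁ ∈ 𝒱][x₃ ∈ 𝒲] − [x₁ ∈ 𝒲][x₂ ∈ 𝒱] − [x₂ ∈ 𝒱∩𝒲]`   (`gtKernel`)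
one has **`threePartNT τ 𝒰 𝒱 𝒲 = ∑_q [x₁(q) ∈ 𝒰]·κ_{τ,𝒱,𝒲}(q)`** (`threePartNT_eq_sum_gtKernel`; relabelling the parts).  So COMB-C3
says: for every `(τ,𝒱,𝒲)` the negative part of `κ` is transportable to its positive part along "copy 1 grows" (Hall/Strassen).
THE CONJECTURE (this work, OPEN).  **`GridTransport`**: the transport can even be done along the PRODUCT ORDER "copy 1 grows and
copy 2 shrinks" (a product of three-element chains), i.e. `∑_{q ∈ 𝒰} κ(q) ≥ 0` for every family `𝒰` of configurations closed
upwards in that order.  `threePartitionPositivityTwisted_of_gridTransport`: it implies `ThreePartitionPositivityTwisted` (cylinders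
`{x₁ ∈ 𝒰}` are closed upwards).  EVIDENCE (not kernel facts; seat code `e3gt.c`, kit j288403): true for ALL `(τ,𝒱,𝒲)` on `≤ 4`
points (`445 642` nontrivial triples), ALL on `5` points (exhaustive modulo `S₅`: `50 694 192` nontrivial triples) and `9.6·10⁵` random
triples on `6` points — `0` failures; the sibling orders ("copy 3 shrinks", "moves into copy 1 only"), every two-term sub-kernel and
every simplification of the region `{x₃ ∈ 𝒲}` FAIL already on `≤ 3` points, so the statement is rigid.  With `𝒲 = ⊤` it is the
Harris–Kleitman inequality of the grid `[3]^n`; in general it reads "two grid-Kleitman slacks dominate the Kleitman difference of the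
non-monotone family `{x₃ ∈ 𝒲} ∩ {x₁ ∈ 𝒱}`" — the shape of the two-up-set core `ThreeSetHallD` (proved in `…TwoPartitionCoreProof`)
one copy up.  The linear-algebra proof of the core does NOT transfer (on grids the Hall matrices are rank-deficient).
HONEST LABEL: an identity (proved), a conjecture (open) and its one-line consequence; COMB-C3 / Sahi's `C₃` remain OPEN; nothing here
bears on the crux. [this work]
-/

noncomputable section

open Finset
open scoped symmDiff Classical

namespace Summit.CriticalPhenomena.PercolationContinuityZ3.Theorems.ThreePartition

variable {ι : Type*} [Fintype ι]

/-! ## Configurations, copies, the kernel -/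

/-- Indicator of membership of a set in a family, as an integer. [this work] -/
def ind (𝒳 : Set (Set ι)) (x : Set ι) : ℤ := if x ∈ 𝒳 then 1 else 0

/-- Copy 1 of the configuration `q = (S₁, S₂)` (third part `S₃ = (S₁ ∪ S₂)ᶜ`), twisted by `τ`: `S₁ ∆ τ`. [this work] -/
def cp₁ (τ : Set ι) (q : Set ι × Set ι) : Set ι := q.1 ∆ τ
/-- Copy 2: `S₂ ∆ τ`. [this work] -/
def cp₂ (τ : Set ι) (q : Set ι × Set ι) : Set ι := q.2 ∆ τ
/-- Copy 3: `S₃ ∆ τ = (S₁ ∪ S₂)ᶜ ∆ τ`. [this work] -/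
def cp₃ (τ : Set ι) (q : Set ι × Set ι) : Set ι := (q.1 ∪ q.2)ᶜ ∆ τ

/-- The configurations: ordered 3-partitions of `ι`, encoded as disjoint pairs `(S₁, S₂)`. [this work] -/
def cfgs (ι : Type*) [Fintype ι] : Finset (Set ι × Set ι) := univ.filter fun q => Disjoint q.1 q.2

/-- **The three-copy kernel with the test family on copy 1 removed** (canonical block → copy assignment):
`κ_{τ,𝒱,𝒲}(q) = 2[x₁ ∈ 𝒱∩𝒲] + [x₂ ∈ 𝒱][x₃ ∈ 𝒲] − [x₁ ∈ 𝒱][x₃ ∈ 𝒲] − [x₁ ∈ 𝒲][x₂ ∈ 𝒱] − [x₂ ∈ 𝒱∩𝒲]`, `x_a = cp_a τ q`. [this work] -/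
def gtKernel (τ : Set ι) (𝒱 𝒲 : Set (Set ι)) (q : Set ι × Set ι) : ℤ :=
  2 * ind (𝒱 ∩ 𝒲) (cp₁ τ q) + ind 𝒱 (cp₂ τ q) * ind 𝒲 (cp₃ τ q) - ind 𝒱 (cp₁ τ q) * ind 𝒲 (cp₃ τ q)
    - ind 𝒲 (cp₁ τ q) * ind 𝒱 (cp₂ τ q) - ind (𝒱 ∩ 𝒲) (cp₂ τ q)

/-- **CONJECTURE `GridTransport`** (this work; OPEN).  Order the configurations by "copy 1 grows and copy 2 shrinks":
`q ≤ q' ⟺ x₁(q) ⊆ x₁(q') ∧ x₂(q') ⊆ x₂(q)` (a product of `|ι|` three-element chains).  For all up-sets `𝒱, 𝒲` of a finite cube,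
every twist `τ`, and every family `𝒰` of configurations closed upwards in this order, `∑_{q ∈ 𝒰} κ_{τ,𝒱,𝒲}(q) ≥ 0` — i.e. the
negative part of the kernel is transportable to its positive part along the grid order.  Implies `ThreePartitionPositivityTwisted`
(`threePartitionPositivityTwisted_of_gridTransport`), hence COMB-C3 and Sahi's `C₃` for product measures.  EVIDENCE (seat code
`e3gt.c`, kit j288403): all `(τ,𝒱,𝒲)` on `≤ 4` points, all on `5` points (exhaustive modulo `S₅`, `5.07·10⁷` nontrivial triples) and
`9.6·10⁵` random triples on `6` points — `0` failures.  An obligation / hypothesis — never a fact. [this work] [status: open] -/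
@[conjecture] def GridTransport : Prop :=
  ∀ (ι : Type) [Fintype ι] (τ : Set ι) (𝒱 𝒲 : Set (Set ι)) (𝒰 : Set (Set ι × Set ι)),
    IsUpperSet 𝒱 → IsUpperSet 𝒲 →
    (∀ q q' : Set ι × Set ι, q ∈ 𝒰 → q.1 ∆ τ ⊆ q'.1 ∆ τ → q'.2 ∆ τ ⊆ q.2 ∆ τ → q' ∈ 𝒰) →
    0 ≤ ∑ q ∈ (cfgs ι).filter (fun q => q ∈ 𝒰), gtKernel τ 𝒱 𝒲 q

/-! ## Relabelling the parts -/

omit [Fintype ι] in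
/-- For disjoint `S₁, S₂`: `(S₁ ∪ (S₁ ∪ S₂)ᶜ)ᶜ = S₂`. [folklore] -/
theorem compl_union_compl_eq_snd {S₁ S₂ : Set ι} (h : Disjoint S₁ S₂) : (S₁ ∪ (S₁ ∪ S₂)ᶜ)ᶜ = S₂ := by
  ext x
  have hx : x ∈ S₁ → x ∉ S₂ := fun h1 h2 => Set.disjoint_left.1 h h1 h2
  simp only [Set.compl_union, Set.mem_compl_iff, Set.mem_inter_iff]
  tauto

/-- Swapping parts 1 and 3: `#{q : P(x₁,x₂,x₃)} = #{q : P(x₃,x₂,x₁)}`. [this work] -/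
theorem card_cfgs_swap13 (τ : Set ι) (P : Set ι → Set ι → Set ι → Prop) :
    #((cfgs ι).filter fun q => P (cp₁ τ q) (cp₂ τ q) (cp₃ τ q))
      = #((cfgs ι).filter fun q => P (cp₃ τ q) (cp₂ τ q) (cp₁ τ q)) := by
  refine card_bij (fun q _ => ((q.1 ∪ q.2)ᶜ, q.2)) (fun q hq => ?_) (fun q hq q' hq' h => ?_) (fun q hq => ?_)
  · simp only [cfgs, mem_filter, mem_univ, true_and, cp₁, cp₂, cp₃] at hq ⊢
    obtain ⟨hd, hP⟩ := hq
    refine ⟨Set.disjoint_left.2 fun x hx hx2 => hx (Or.inr hx2), ?_⟩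
    rw [compl_union_compl_union_eq hd]; exact hP
  · simp only [cfgs, mem_filter, mem_univ, true_and] at hq hq'
    simp only [Prod.mk.injEq] at h
    have e1 : q.1 = q'.1 := by
      rw [← compl_union_compl_union_eq hq.1, ← compl_union_compl_union_eq hq'.1, h.1, h.2]
    exact Prod.ext e1 h.2
  · simp only [cfgs, mem_filter, mem_univ, true_and, cp₁, cp₂, cp₃] at hq
    obtain ⟨hd, hP⟩ := hq
    have hd' : Disjoint (q.1 ∪ q.2)ᶜ q.2 := Set.disjoint_left.2 fun x hx hx2 => hx (Or.inr hx2)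
    refine ⟨((q.1 ∪ q.2)ᶜ, q.2), ?_, ?_⟩
    · simp only [cfgs, mem_filter, mem_univ, true_and, cp₁, cp₂, cp₃]
      refine ⟨hd', ?_⟩
      rw [compl_union_compl_union_eq hd]; exact hP
    · simp only [compl_union_compl_union_eq hd]

/-- Swapping parts 2 and 3: `#{q : P(x₁,x₂,x₃)} = #{q : P(x₁,x₃,x₂)}`. [this work] -/
theorem card_cfgs_swap23 (τ : Set ι) (P : Set ι → Set ι → Set ι → Prop) :
    #((cfgs ι).filter fun q => P (cp₁ τ q) (cp₂ τ q) (cp₃ τ q))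
      = #((cfgs ι).filter fun q => P (cp₁ τ q) (cp₃ τ q) (cp₂ τ q)) := by
  refine card_bij (fun q _ => (q.1, (q.1 ∪ q.2)ᶜ)) (fun q hq => ?_) (fun q hq q' hq' h => ?_) (fun q hq => ?_)
  · simp only [cfgs, mem_filter, mem_univ, true_and, cp₁, cp₂, cp₃] at hq ⊢
    obtain ⟨hd, hP⟩ := hq
    refine ⟨Set.disjoint_left.2 fun x hx hx2 => hx2 (Or.inl hx), ?_⟩
    rw [compl_union_compl_eq_snd hd]; exact hP
  · simp only [cfgs, mem_filter, mem_univ, true_and] at hq hq'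
    simp only [Prod.mk.injEq] at h
    have a := compl_union_compl_eq_snd hq.1
    have b := compl_union_compl_eq_snd hq'.1
    obtain ⟨h1, h2⟩ := h
    have e2 : q.2 = q'.2 := by
      calc q.2 = (q.1 ∪ (q.1 ∪ q.2)ᶜ)ᶜ := a.symm
        _ = (q'.1 ∪ (q'.1 ∪ q'.2)ᶜ)ᶜ := by rw [h2, h1]
        _ = q'.2 := b
    exact Prod.ext h1 e2
  · simp only [cfgs, mem_filter, mem_univ, true_and, cp₁, cp₂, cp₃] at hq
    obtain ⟨hd, hP⟩ := hq
    have hd' : Disjoint q.1 (q.1 ∪ q.2)ᶜ := Set.disjoint_left.2 fun x hx hx2 => hx2 (Or.inl hx)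
    refine ⟨(q.1, (q.1 ∪ q.2)ᶜ), ?_, ?_⟩
    · simp only [cfgs, mem_filter, mem_univ, true_and, cp₁, cp₂, cp₃]
      refine ⟨hd', ?_⟩
      rw [compl_union_compl_eq_snd hd]; exact hP
    · simp only [compl_union_compl_eq_snd hd]

/-! ## The counts of the twisted functional as configuration counts -/

/-- `triT τ p = #{q ∈ cfgs : p(x₁,x₂,x₃)}`. [this work] -/
theorem triT_eq_card_cfgs (τ : Set ι) (p : Set ι → Set ι → Set ι → Prop) :
    triT τ p = #((cfgs ι).filter fun q => p (cp₁ τ q) (cp₂ τ q) (cp₃ τ q)) := by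
  unfold triT tri cfgs
  rw [filter_filter]
  rfl

omit [Fintype ι] in
/-- Product of two indicators. [folklore] -/
theorem ind_mul_ind (𝒳 𝒴 : Set (Set ι)) (x y : Set ι) : ind 𝒳 x * ind 𝒴 y = if x ∈ 𝒳 ∧ y ∈ 𝒴 then 1 else 0 := by
  unfold ind; split_ifs <;> simp_all

/-- The kernel sum, term by term, as configuration counts. [this work] -/
theorem sum_ind_mul_gtKernel (τ : Set ι) (𝒰 𝒱 𝒲 : Set (Set ι)) :
    ∑ q ∈ cfgs ι, ind 𝒰 (cp₁ τ q) * gtKernel τ 𝒱 𝒲 q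
      = 2 * (#((cfgs ι).filter fun q => cp₁ τ q ∈ 𝒰 ∧ cp₁ τ q ∈ 𝒱 ∩ 𝒲) : ℤ)
        + #((cfgs ι).filter fun q => cp₁ τ q ∈ 𝒰 ∧ (cp₂ τ q ∈ 𝒱 ∧ cp₃ τ q ∈ 𝒲))
        - #((cfgs ι).filter fun q => cp₁ τ q ∈ 𝒰 ∧ (cp₁ τ q ∈ 𝒱 ∧ cp₃ τ q ∈ 𝒲))
        - #((cfgs ι).filter fun q => cp₁ τ q ∈ 𝒰 ∧ (cp₁ τ q ∈ 𝒲 ∧ cp₂ τ q ∈ 𝒱))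
        - #((cfgs ι).filter fun q => cp₁ τ q ∈ 𝒰 ∧ cp₂ τ q ∈ 𝒱 ∩ 𝒲) := by
  have e : ∀ q, ind 𝒰 (cp₁ τ q) * gtKernel τ 𝒱 𝒲 q
      = 2 * (if cp₁ τ q ∈ 𝒰 ∧ cp₁ τ q ∈ 𝒱 ∩ 𝒲 then (1 : ℤ) else 0)
        + (if cp₁ τ q ∈ 𝒰 ∧ (cp₂ τ q ∈ 𝒱 ∧ cp₃ τ q ∈ 𝒲) then (1 : ℤ) else 0)
        - (if cp₁ τ q ∈ 𝒰 ∧ (cp₁ τ q ∈ 𝒱 ∧ cp₃ τ q ∈ 𝒲) then (1 : ℤ) else 0)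
        - (if cp₁ τ q ∈ 𝒰 ∧ (cp₁ τ q ∈ 𝒲 ∧ cp₂ τ q ∈ 𝒱) then (1 : ℤ) else 0)
        - (if cp₁ τ q ∈ 𝒰 ∧ cp₂ τ q ∈ 𝒱 ∩ 𝒲 then (1 : ℤ) else 0) := by
    intro q
    unfold gtKernel ind
    by_cases a : cp₁ τ q ∈ 𝒰 <;> by_cases b : cp₁ τ q ∈ 𝒱 <;> by_cases c : cp₁ τ q ∈ 𝒲 <;> by_cases d : cp₂ τ q ∈ 𝒱 <;>
      by_cases e : cp₂ τ q ∈ 𝒲 <;> by_cases f : cp₃ τ q ∈ 𝒲 <;> simp [a, b, c, d, e, f, Set.mem_inter_iff]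
  rw [Finset.sum_congr rfl fun q _ => e q]
  simp only [Finset.sum_sub_distrib, Finset.sum_add_distrib, ← Finset.mul_sum, natCast_card_filter]

/-- **The twisted three-partition functional is the kernel sum**: `N_τ(𝒰,𝒱,𝒲) = ∑_q [x₁(q) ∈ 𝒰]·κ_{τ,𝒱,𝒲}(q)`
(relabel the parts: `topT` by `1 ↔ 3`, `deeT 𝒰 (𝒱∩𝒲)` by `2 ↔ 3`, `deeT 𝒱 (𝒰∩𝒲)` by `1 ↔ 3` then `2 ↔ 3`, `deeT 𝒲 (𝒰∩𝒱)` by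
`1 ↔ 3`). [this work] -/
theorem threePartNT_eq_sum_gtKernel (τ : Set ι) (𝒰 𝒱 𝒲 : Set (Set ι)) :
    threePartNT τ 𝒰 𝒱 𝒲 = ∑ q ∈ cfgs ι, ind 𝒰 (cp₁ τ q) * gtKernel τ 𝒱 𝒲 q := by
  rw [sum_ind_mul_gtKernel]
  -- the five counts
  have h1 : topT τ (𝒰 ∩ 𝒱 ∩ 𝒲) = #((cfgs ι).filter fun q => cp₁ τ q ∈ 𝒰 ∧ cp₁ τ q ∈ 𝒱 ∩ 𝒲) := by
    unfold topT
    rw [triT_eq_card_cfgs, card_cfgs_swap13 τ (fun _ _ x₃ => x₃ ∈ 𝒰 ∩ 𝒱 ∩ 𝒲)]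
    congr 1
    ext q
    simp only [mem_filter, Set.mem_inter_iff]
    tauto
  have h2 : teeT τ 𝒰 𝒱 𝒲 = #((cfgs ι).filter fun q => cp₁ τ q ∈ 𝒰 ∧ (cp₂ τ q ∈ 𝒱 ∧ cp₃ τ q ∈ 𝒲)) := by
    unfold teeT
    rw [triT_eq_card_cfgs]
    congr 1
    ext q
    simp only [mem_filter]
  have h3 : deeT τ 𝒰 (𝒱 ∩ 𝒲) = #((cfgs ι).filter fun q => cp₁ τ q ∈ 𝒰 ∧ cp₂ τ q ∈ 𝒱 ∩ 𝒲) := by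
    unfold deeT
    rw [triT_eq_card_cfgs, card_cfgs_swap23 τ (fun x₁ _ x₃ => x₁ ∈ 𝒰 ∧ x₃ ∈ 𝒱 ∩ 𝒲)]
    congr 1
    ext q
    simp only [mem_filter]
  have h4 : deeT τ 𝒱 (𝒰 ∩ 𝒲) = #((cfgs ι).filter fun q => cp₁ τ q ∈ 𝒰 ∧ (cp₁ τ q ∈ 𝒲 ∧ cp₂ τ q ∈ 𝒱)) := by
    unfold deeT
    rw [triT_eq_card_cfgs, card_cfgs_swap13 τ (fun x₁ _ x₃ => x₁ ∈ 𝒱 ∧ x₃ ∈ 𝒰 ∩ 𝒲),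
      card_cfgs_swap23 τ (fun x₁ _ x₃ => x₃ ∈ 𝒱 ∧ x₁ ∈ 𝒰 ∩ 𝒲)]
    congr 1
    ext q
    simp only [mem_filter, Set.mem_inter_iff]
    tauto
  have h5 : deeT τ 𝒲 (𝒰 ∩ 𝒱) = #((cfgs ι).filter fun q => cp₁ τ q ∈ 𝒰 ∧ (cp₁ τ q ∈ 𝒱 ∧ cp₃ τ q ∈ 𝒲)) := by
    unfold deeT
    rw [triT_eq_card_cfgs, card_cfgs_swap13 τ (fun x₁ _ x₃ => x₁ ∈ 𝒲 ∧ x₃ ∈ 𝒰 ∩ 𝒱)]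
    congr 1
    ext q
    simp only [mem_filter, Set.mem_inter_iff]
    tauto
  unfold threePartNT
  rw [h1, h2, h3, h4, h5]
  push_cast
  ring

/-- **`GridTransport` implies twisted three-partition positivity** (hence COMB-C3 and Sahi's `C₃` for product measures):
the cylinder `{q : x₁(q) ∈ 𝒰}` is closed upwards in the grid order, and on it the kernel sums to `N_τ(𝒰,𝒱,𝒲)`.
[this work] [status: conditional on `GridTransport`] -/
theorem threePartitionPositivityTwisted_of_gridTransport (h : GridTransport) : ThreePartitionPositivityTwisted := by
  intro ι _ τ 𝒰 𝒱 𝒲 h𝒰 h𝒱 h𝒲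
  rw [threePartNT_eq_sum_gtKernel]
  have e : ∑ q ∈ cfgs ι, ind 𝒰 (cp₁ τ q) * gtKernel τ 𝒱 𝒲 q
      = ∑ q ∈ (cfgs ι).filter (fun q => q ∈ {q : Set ι × Set ι | q.1 ∆ τ ∈ 𝒰}), gtKernel τ 𝒱 𝒲 q := by
    rw [Finset.sum_filter]
    refine Finset.sum_congr rfl fun q _ => ?_
    unfold ind cp₁
    simp only [Set.mem_setOf_eq]
    split_ifs <;> simp
  rw [e]
  refine h ι τ 𝒱 𝒲 {q : Set ι × Set ι | q.1 ∆ τ ∈ 𝒰} h𝒱 h𝒲 fun q q' hq h1 _ => ?_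
  simp only [Set.mem_setOf_eq] at hq ⊢
  exact h𝒰 h1 hq

/-- Hence `GridTransport` also implies the untwisted `ThreePartitionPositivity`. [this work] [status: conditional on `GridTransport`] -/
theorem threePartitionPositivity_of_gridTransport (h : GridTransport) : ThreePartitionPositivity :=
  threePartitionPositivity_of_twisted (threePartitionPositivityTwisted_of_gridTransport h)

end Summit.CriticalPhenomena.PercolationContinuityZ3.Theorems.ThreePartition

end
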